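import Summits.ValiantsHypothesis.ValiantsHypothesis.Theorems.BarrierLeverNaturalProofsSeparateVNPPermanent
import Summits.ValiantsHypothesis.ValiantsHypothesis.Theorems.BarrierLeverNaturalProofsSeparateVNPReframing

/-!
# Route BarrierLever — item `NaturalProofsSeparateVNP` (stmt-ValiantsHypothesis-18972):
# the permanent normal form AT LEVEL ONE (cell valiant-natproofs, seat val-np-p4; rung V4)

Sequel of `…NaturalProofsSeparateVNPPermanent` (`S ↔ NaturalProofAgainstVP ℂ 2 (per_⌊√n⌋ framed)`,
`S := Theses.BarrierLever.NaturalProofsSeparateVNP`) and `…NaturalProofsSeparateVNPReframing`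
(free pull-backs; level reduction for re-framable families).  The item is stated with LEVEL-ONE
distinguishers (size and degree `≤ N = C(2n,n)`); this file closes the loop at level one, with a
sparser framing of the permanent, `per_⌊n^{1/4}⌋` in the first `⌊n^{1/4}⌋²` of the `n` variables —
written out as `rename (Fin.castLE _ ∘ finProdFinEquiv) (perPoly (Fin n.sqrt.sqrt) ℂ)`; no
definition is introduced:

* `Permanent.naturalProofsSeparateVNP_iff_naturalProofAgainstVP_perFrame4` — **for every `a ≥ 1`,
  `S ↔ NaturalProofAgainstVP ℂ a (per_⌊n^{1/4}⌋ framed)`**: item 18972 is EXACTLY the barrier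
  catalogue's technique class `NaturalProofAgainstVP ℂ 1`
  (`Literature/Barriers/ValiantsHypothesis/AlgebraicNaturalProofs.lean`) at the permanent, and the
  level is immaterial from `1` on (as for the item itself, `…Level`).
  `⇒` (`naturalProofAgainstVP_one_perFrame4_of_naturalProofsSeparateVNP`): re-frame the level-two
  proof at `per_⌊√n⌋` — `per_s`, `s = ⌊√n⌋ ≥ 3`, sits at `n'' = s⁴ ∈ (n, n²]` with `⌊n''^{1/4}⌋ = s`,
  the re-framing is a renaming substitution (`reframe_aux`, frame sizes as free parameters so that
  `⌊(s⁴)^{1/4}⌋ = s` is a `subst`), and `C(2n,n)² ≤ C(4n,2n) ≤ C(2s⁴,s⁴)` absorbs the level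
  (`Projections.naturalProofAgainstVP_one_of_reframing`).
  `⇐` (any level): `per_⌊n^{1/4}⌋` framed is eventually in `SmallDefinable ℂ n b₁`
  (`perFrame4_mem_smallDefinable_eventually`, from `(per_n) ∈ VNP` = `isVNPFamily_perPoly_holds`)
  and the item's level is immaterial (`naturalProofsSeparateVNP_of_level`).
* `Permanent.naturalProofAgainstVP_one_perFrame4_iff_not_crux` — under `PermanentExpHardWith ℂ c m₀`:
  FSV Question 6 fails over `ℂ` iff LEVEL-ONE algebraically natural proofs certify, infinitely
  often against every polynomial size bound, that the permanent is not in `VP`.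

Why the sparser framing: with `⌊√n⌋²` of the `n` frame variables live a pulled-back level-one
distinguisher would have to pay `≥ N'` for genuinely linear forms (Valiant's projection uses
constants); along a pure re-framing nothing is paid, and the frame `s⁴ ≥ 2n` absorbs the square.

WHAT THIS IS NOT: item 18972 stays OPEN (parked on the crux, item 14610); nothing here is evidence
for `VP ≠ VNP`, for FSV Question 6 either way, or for any hardness of the permanent — equivalences
between open statements only.

References: [ForbesShpilkaVolk2018] Def. 1, §1.2, Cor. 5, Question 6; [Valiant1979];
[Burgisser2000] Def. 2.5–2.6, Thm. 2.10; [KumarRamyaSaptharishiTengse2022] §1.2.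
-/

-- layout Summits/ValiantsHypothesis/ValiantsHypothesis forces the duplicated namespace component
set_option linter.dupNamespace false

noncomputable section

namespace Summit.ValiantsHypothesis.ValiantsHypothesis.Theorems.BarrierLever.NaturalProofsSeparateVNP

open Literature.Barriers.ValiantsHypothesis Literature.Computability.AlgebraicComplexity MvPolynomial
open Summit.ValiantsHypothesis.ValiantsHypothesis.Theses

open Projections

namespace Permanent

/-! ### The sparsely framed permanent `per_⌊n^{1/4}⌋` and the level-ONE normal form -/

section Sparse

/-- Frame inequality for the sparse framing: `⌊√⌊√n⌋⌋² ≤ n`. [folklore] -/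
theorem sqrt_sqrt_sq_le (n : ℕ) : n.sqrt.sqrt * n.sqrt.sqrt ≤ n :=
  (Nat.sqrt_le n.sqrt).trans (Nat.sqrt_le_self n)

/-- The sparsely framed permanent `per_⌊n^{1/4}⌋` (in the first `⌊n^{1/4}⌋²` of `n` variables) has
degree `≤ n`. [cite: ForbesShpilkaVolk2018, §1.2] -/
theorem totalDegree_perFrame4_le (n : ℕ) :
    (rename (Fin.castLE (sqrt_sqrt_sq_le n) ∘ finProdFinEquiv)
      (perPoly (Fin n.sqrt.sqrt) ℂ)).totalDegree ≤ n := by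
  refine (totalDegree_rename_le _ _).trans ?_
  have h := (perPoly_isHomogeneous (n := Fin n.sqrt.sqrt) (k := ℂ)).totalDegree_le
  rw [Fintype.card_fin] at h
  exact h.trans ((Nat.sqrt_le_self _).trans (Nat.sqrt_le_self n))

/-- The sparsely framed permanent is eventually in `SmallDefinable ℂ n b₁` for one `b₁`
(`(per_n) ∈ VNP`, the tree's `isVNPFamily_perPoly_holds`). [cite: Valiant1979] -/
theorem perFrame4_mem_smallDefinable_eventually :
    ∃ b₁ n₁ : ℕ, ∀ n : ℕ, n₁ ≤ n →
      rename (Fin.castLE (sqrt_sqrt_sq_le n) ∘ finProdFinEquiv) (perPoly (Fin n.sqrt.sqrt) ℂ) ∈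
        SmallDefinable ℂ n b₁ := by
  obtain ⟨-, u, g, ⟨⟨hcard, hgdeg⟩, hgcomp⟩, hgeq⟩ := isVNPFamily_perPoly_holds ℂ
  obtain ⟨A₁, B₁, h₁⟩ := (IsPBounded.iff_exists_le_mul_succ_pow _).1 hcard
  obtain ⟨A₂, B₂, h₂⟩ := (IsPBounded.iff_exists_le_mul_succ_pow _).1 hgdeg
  obtain ⟨A₃, B₃, h₃⟩ := (IsPBounded.iff_exists_le_mul_succ_pow _).1 hgcomp
  set A := A₁ + A₂ + A₃ with hA
  set B := B₁ + B₂ + B₃ with hB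
  refine ⟨B + 1, A * 2 ^ B + 1, fun n hn => ?_⟩
  set s := n.sqrt.sqrt with hs
  have hsn : s ≤ n := (Nat.sqrt_le_self _).trans (Nat.sqrt_le_self n)
  have absorb : ∀ {q Aᵢ Bᵢ : ℕ}, q ≤ Aᵢ * (s + 1) ^ Bᵢ → Aᵢ ≤ A → Bᵢ ≤ B → q ≤ n ^ (B + 1) := by
    intro q Aᵢ Bᵢ hq hAᵢ hBᵢ
    calc q ≤ Aᵢ * (s + 1) ^ Bᵢ := hq
      _ ≤ A * (n + 1) ^ B := Nat.mul_le_mul hAᵢ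
          ((Nat.pow_le_pow_left (by omega) _).trans (Nat.pow_le_pow_right (by omega) hBᵢ))
      _ ≤ n ^ (B + 1) := poly_absorb A B n hn
  have hu : u s ≤ n ^ (B + 1) := by
    refine absorb ((?_ : u s ≤ _).trans (h₁ s)) (by omega) (by omega)
    rw [Fintype.card_sum, Fintype.card_fin]
    exact Nat.le_add_left _ _
  refine ⟨totalDegree_perFrame4_le n, u s, hu,
    rename (Sum.map (Fin.castLE (sqrt_sqrt_sq_le n) ∘ finProdFinEquiv) id) (g s), ?_, ?_, ?_⟩
  · exact absorb ((complexity_rename_le_holds' _ _).trans (h₃ s)) (by omega) (by omega)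
  · exact absorb ((totalDegree_rename_le _ _).trans (h₂ s)) (by omega) (by omega)
  · rw [boolSum_rename_sumMap, ← hgeq s]

/-- **Re-framing the permanent is a renaming substitution** (proof-irrelevant form, the two frame
sizes `s²  ≤ n` and `r² ≤ n''` with `r = s` as free parameters): sending the first `s²` variables
of the big frame to the first `s²` variables of the small frame and killing the rest maps
`per_r` framed at `n''` to `per_s` framed at `n`. [folklore] -/
theorem reframe_aux {r s n n'' : ℕ} (p₁ : s * s ≤ n) (p₂ : r * r ≤ n'') (hrs : r = s) :
    ∃ e : Fin n'' → Option (Fin n), (∀ i i' x, e i = some x → e i' = some x → i = i') ∧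
      rename (Fin.castLE p₁ ∘ finProdFinEquiv) (perPoly (Fin s) ℂ) =
        aeval (fun i => (e i).elim (0 : MvPolynomial (Fin n) ℂ) X)
          (rename (Fin.castLE p₂ ∘ finProdFinEquiv) (perPoly (Fin r) ℂ)) := by
  subst hrs
  refine ⟨fun v => if hv : (v : ℕ) < r * r then some (Fin.castLE p₁ ⟨v, hv⟩) else none,
    fun i i' x hi hi' => ?_, ?_⟩
  · dsimp only at hi hi'
    by_cases hvi : (i : ℕ) < r * r
    · by_cases hvi' : (i' : ℕ) < r * r
      · rw [dif_pos hvi] at hi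
        rw [dif_pos hvi'] at hi'
        have h1 := Option.some_injective _ (hi.trans hi'.symm)
        have h2 : (⟨(i : ℕ), hvi⟩ : Fin (r * r)) = ⟨(i' : ℕ), hvi'⟩ := Fin.castLE_injective p₁ h1
        exact Fin.ext (by simpa using congrArg Fin.val h2)
      · rw [dif_neg hvi'] at hi'; exact absurd hi' (by simp)
    · rw [dif_neg hvi] at hi; exact absurd hi (by simp)
  · rw [aeval_rename]
    have hfun : ((fun v : Fin n'' => (if hv : (v : ℕ) < r * r then some (Fin.castLE p₁ ⟨v, hv⟩)
        else none).elim (0 : MvPolynomial (Fin n) ℂ) X) ∘ (Fin.castLE p₂ ∘ finProdFinEquiv)) =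
        X ∘ (Fin.castLE p₁ ∘ (finProdFinEquiv : Fin r × Fin r ≃ Fin (r * r))) := by
      funext ij
      have hlt : ((Fin.castLE p₂ (finProdFinEquiv ij) : Fin n'') : ℕ) < r * r := by
        rw [Fin.val_castLE]; exact (finProdFinEquiv ij).isLt
      simp only [Function.comp_apply]
      rw [dif_pos hlt]
      simp only [Option.elim_some]
      congr 1
    rw [hfun]
    have hre : (rename (Fin.castLE p₁ ∘ (finProdFinEquiv : Fin r × Fin r ≃ Fin (r * r))) :
          MvPolynomial (Fin r × Fin r) ℂ →ₐ[ℂ] MvPolynomial (Fin n) ℂ) =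
        aeval (X ∘ (Fin.castLE p₁ ∘ (finProdFinEquiv : Fin r × Fin r ≃ Fin (r * r)))) :=
      MvPolynomial.algHom_ext fun ij => by rw [rename_X, aeval_X]; rfl
    exact DFunLike.congr_fun hre _

/-- **Item 18972 ⇒ a LEVEL-ONE algebraically natural proof that the (sparsely framed) permanent is
not in `VP`.** From the level-two proof at `per_⌊√n⌋` (`…Permanent`), re-frame `per_s`
(`s = ⌊√n⌋ ≥ 3`) at `n'' = s⁴ ∈ (n, n²]`, where `⌊n''^{1/4}⌋ = s` and `C(2n,n)² ≤ C(4n,2n) ≤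
C(2n'',n'')` (`2n ≤ s⁴`); the pull-back is free (`naturalProofAgainstVP_one_of_reframing`).
[cite: Valiant1979] [cite: ForbesShpilkaVolk2018, Def. 1, §1.2 and Cor. 5] -/
theorem naturalProofAgainstVP_one_perFrame4_of_naturalProofsSeparateVNP
    (hS : BarrierLever.NaturalProofsSeparateVNP) :
    NaturalProofAgainstVP ℂ 1
      (fun n => rename (Fin.castLE (sqrt_sqrt_sq_le n) ∘ finProdFinEquiv)
        (perPoly (Fin n.sqrt.sqrt) ℂ)) := by
  refine Projections.naturalProofAgainstVP_one_of_reframing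
    (naturalProofAgainstVP_perFrame_of_naturalProofsSeparateVNP hS) ⟨1, 2, 9, fun n hn => ?_⟩
  set s := n.sqrt with hs
  have hs3 : 3 ≤ s := by
    rw [hs, Nat.le_sqrt]; omega
  have hnlt : n < (s + 1) * (s + 1) := Nat.lt_succ_sqrt n
  have hsn : s * s ≤ n := Nat.sqrt_le n
  -- `(s+1)² ≤ s⁴ / 2`-type bounds for `s ≥ 3`
  have hs4 : 2 * ((s + 1) * (s + 1)) ≤ (s * s) * (s * s) := by
    have h9 : 9 ≤ s * s := Nat.mul_le_mul hs3 hs3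
    calc 2 * ((s + 1) * (s + 1)) ≤ 9 * (s * s) := by nlinarith
      _ ≤ (s * s) * (s * s) := Nat.mul_le_mul_right _ h9
  have hsqrt : ((s * s) * (s * s)).sqrt.sqrt = s := by rw [Nat.sqrt_eq, Nat.sqrt_eq]
  obtain ⟨e, hinj, heq⟩ := reframe_aux (n := n) (n'' := (s * s) * (s * s)) (Nat.sqrt_le n)
    (sqrt_sqrt_sq_le ((s * s) * (s * s))) hsqrt
  refine ⟨(s * s) * (s * s), by omega, ?_, totalDegree_perFrame4_le _, ?_, e, hinj, heq⟩
  · calc (s * s) * (s * s) ≤ n * n := Nat.mul_le_mul hsn hsn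
      _ ≤ 1 * (n + 1) ^ 2 := by nlinarith
  · calc ((2 * n).choose n) ^ 2 ≤ (2 * (2 * n)).choose (2 * n) := Projections.centralBinom_pow_le n 2
      _ ≤ (2 * ((s * s) * (s * s))).choose ((s * s) * (s * s)) := centralBinom_mono (by omega)

/-- Conversely, at any level, a natural proof at the sparsely framed permanent gives the item.
[cite: Valiant1979] [cite: ForbesShpilkaVolk2018, Question 6] -/
theorem naturalProofsSeparateVNP_of_naturalProofAgainstVP_perFrame4 (a : ℕ)
    (hnat : NaturalProofAgainstVP ℂ a
      (fun n => rename (Fin.castLE (sqrt_sqrt_sq_le n) ∘ finProdFinEquiv)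
        (perPoly (Fin n.sqrt.sqrt) ℂ))) :
    BarrierLever.NaturalProofsSeparateVNP := by
  obtain ⟨b₁, n₁, hmem⟩ := perFrame4_mem_smallDefinable_eventually
  refine naturalProofsSeparateVNP_of_level a ⟨b₁, fun b n₀ => ?_⟩
  obtain ⟨n, hn, D, hD, hne⟩ := hnat b (max n₀ n₁)
  exact ⟨n, (le_max_left _ _).trans hn, D, hD, _, hmem n ((le_max_right _ _).trans hn), hne⟩

/-- **LEVEL-ONE PERMANENT NORMAL FORM of item 18972, at every level `a ≥ 1`.**
`NaturalProofsSeparateVNP ↔ NaturalProofAgainstVP ℂ a (per_⌊n^{1/4}⌋ framed in n variables)`: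
the item — itself stated with level-one distinguishers — is EXACTLY the barrier catalogue's
technique class `NaturalProofAgainstVP ℂ 1` (AlgebraicNaturalProofs.lean) at the permanent, and
the level is immaterial from `1` on. [cite: Valiant1979] [cite: ForbesShpilkaVolk2018, Def. 1, Cor. 5 and Question 6] -/
theorem naturalProofsSeparateVNP_iff_naturalProofAgainstVP_perFrame4 {a : ℕ} (ha : 1 ≤ a) :
    BarrierLever.NaturalProofsSeparateVNP ↔ NaturalProofAgainstVP ℂ a
      (fun n => rename (Fin.castLE (sqrt_sqrt_sq_le n) ∘ finProdFinEquiv)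
        (perPoly (Fin n.sqrt.sqrt) ℂ)) :=
  ⟨fun hS => Projections.naturalProofAgainstVP_mono ha
      (naturalProofAgainstVP_one_perFrame4_of_naturalProofsSeparateVNP hS),
    naturalProofsSeparateVNP_of_naturalProofAgainstVP_perFrame4 a⟩

/-- Under exponential hardness of the permanent: FSV Question 6 fails over `ℂ` iff LEVEL-ONE
natural proofs certify that the permanent is not in `VP`. [cite: KumarRamyaSaptharishiTengse2022, §1.2]
[cite: ForbesShpilkaVolk2018, Question 6] -/
theorem naturalProofAgainstVP_one_perFrame4_iff_not_crux {c m₀ : ℕ}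
    (hper : PermanentExpHardWith ℂ c m₀) :
    NaturalProofAgainstVP ℂ 1
        (fun n => rename (Fin.castLE (sqrt_sqrt_sq_le n) ∘ finProdFinEquiv)
          (perPoly (Fin n.sqrt.sqrt) ℂ)) ↔
      ¬ BarrierLever.SuccinctHittingSetsForVP :=
  (naturalProofsSeparateVNP_iff_naturalProofAgainstVP_perFrame4 le_rfl).symm.trans
    (naturalProofsSeparateVNP_iff_not_crux hper)

/-- Cross-link to the border pin (`…Border`): a natural proof of ANY level at the sparsely framed
permanent already puts `(per_n)` (indexed by size) outside `\overline{VP}` — through the item and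
Valiant completeness (`Border.not_isVPBarFamily_perPoly`). [cite: BurgisserEtAl2011, §9.3]
[cite: ForbesShpilkaVolk2018, §1.1] -/
theorem not_isVPBarFamily_perPoly_of_naturalProofAgainstVP_perFrame4 (a : ℕ)
    (hnat : NaturalProofAgainstVP ℂ a
      (fun n => rename (Fin.castLE (sqrt_sqrt_sq_le n) ∘ finProdFinEquiv)
        (perPoly (Fin n.sqrt.sqrt) ℂ))) :
    ¬ IsVPBarFamily fun n => perPoly (Fin n) ℂ :=
  Border.not_isVPBarFamily_perPoly (naturalProofsSeparateVNP_of_naturalProofAgainstVP_perFrame4 a hnat)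

end Sparse

end Permanent

end Summit.ValiantsHypothesis.ValiantsHypothesis.Theorems.BarrierLever.NaturalProofsSeparateVNP

end
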